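import Summits.AtomisticToContinuum.Crystallization.Theses.PhononSlackCertificates
import Summits.AtomisticToContinuum.Crystallization.Theorems.ReggeStarCoercivityDefectFreeCrystallizesSqueezeToLayeredA
import Summits.AtomisticToContinuum.Crystallization.Theorems.ReggeStarCoercivityStarCoercivityTwoShellGoodStarGood
import Summits.AtomisticToContinuum.Crystallization.Theorems.PhononSlackCertificatesHullBridgeWindows

/-!
# Crux `PhononSlackCertificates.HullBridge` (stmt-AtomisticToContinuum-15147), line `Sketch`:
# stub S2 `stub_nonLayeredFraction` — the non-layered fraction vanishes

`NearFieldConvexity` (stmt-13958) at a fixed tolerance `η`, applied with `Ω :=` the set of two-shell-good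
sites of a Lennard-Jones ground state `x N`, bounds `c · #{i : ¬ LayeredNear η (x N) i}` by the total
energy excess `E(x N) − N·e*` (which is `o(N)`, `squeeze_tendsto_excess_div`) plus a constant multiple of
the number of bad sites (boundary layer of depth `4` by packing, `squeeze_card_filter_exists_near_le`;
half site energies `≥ −(125/6)·δ⁻⁶` on the bad sites, `squeeze_neg_le_half_siteEnergy`). Hence, once the
bad fraction vanishes, so does the non-`η`-layered fraction. The inline `η`-layered predicate of
`NearFieldConvexity` is verbatim `PrestressSplitKorn.LayeredNear` (`nl_layeredNear_iff`).
-/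

noncomputable section

open scoped BigOperators Classical
open Filter Topology

namespace Summit.AtomisticToContinuum.Crystallization.Theorems.HullBridgeExact

open Summit.AtomisticToContinuum.Crystallization.Theses.PhononSlackCertificates
open Summit.AtomisticToContinuum.Crystallization.Theorems.PrestressSplitKorn
open Summit.AtomisticToContinuum.Crystallization.Theorems.DefectFreeCrystallizes.Negative.PredicateAPI (Good)
open Literature.MathematicalPhysics.StatisticalMechanics Literature.Geometry.DiscreteGeometry

local notation "E3" => EuclideanSpace ℝ (Fin 3)

/-- The layered set written with three integer indices (format of `NearFieldConvexity` /
`LayeredWindows`) is the range of the labelled map `layeredPos`. -/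
theorem nl_setOf_eq_range (A : E3 →ₗᵢ[ℝ] E3) (a : ℝ) (s : ℤ → ℤ) (z : ℤ → ℝ) :
    {p : E3 | ∃ m i j : ℤ, p = A (((i : ℝ) • triangularVec₁ a) + ((j : ℝ) • triangularVec₂ a) +
      ((haggLabel s m : ℝ) • barlowOffset a) + (z m • layerNormal 1))} =
      Set.range fun l : ℤ × ℤ × ℤ => A (layeredPos a s z l) := by
  ext p
  simp only [Set.mem_setOf_eq, Set.mem_range, layeredPos, Prod.exists]
  constructor
  · rintro ⟨m, i, j, h⟩
    exact ⟨m, i, j, h.symm⟩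
  · rintro ⟨m, i, j, h⟩
    exact ⟨m, i, j, h.symm⟩

/-- **The inline `η`-layered predicate of `NearFieldConvexity` is `LayeredNear η x i`** (same data
`A, t, a, s, z`; the box conjuncts regrouped into `InBox a z`, the layered set rewritten by
`nl_setOf_eq_range`). -/
theorem nl_layeredNear_iff {N : ℕ} (η : ℝ) (x : Fin N → E3) (i : Fin N) :
    (∃ (A : E3 →ₗᵢ[ℝ] E3) (t : E3) (a : ℝ) (s : ℤ → ℤ) (z : ℤ → ℝ), 47 / 50 ≤ a ∧ a ≤ 1 ∧
      IsHaggSeq s ∧ (∀ m : ℤ, 39 / 50 * a ≤ z (m + 1) - z m ∧ z (m + 1) - z m ≤ 17 / 20 * a) ∧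
      let S : Set E3 := {p | ∃ m i j : ℤ, p = A (((i : ℝ) • triangularVec₁ a) +
        ((j : ℝ) • triangularVec₂ a) + ((haggLabel s m : ℝ) • barlowOffset a) + (z m • layerNormal 1))}
      (∀ j : Fin N, dist (x j) (x i) ≤ 2 → ∃ p ∈ S, dist (x j + t) p ≤ η) ∧
        (∀ p ∈ S, dist p (x i + t) ≤ 2 → ∃ j : Fin N, dist (x j + t) p ≤ η)) ↔
    LayeredNear η x i := by
  unfold LayeredNear InBox
  constructor
  · rintro ⟨A, t, a, s, z, ha1, ha2, hs, hz, h⟩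
    refine ⟨A, t, a, s, z, ⟨ha1, ha2, hz⟩, hs, ?_⟩
    simpa only [nl_setOf_eq_range A a s z] using h
  · rintro ⟨A, t, a, s, z, ⟨ha1, ha2, hz⟩, hs, h⟩
    refine ⟨A, t, a, s, z, ha1, ha2, hs, hz, ?_⟩
    simpa only [nl_setOf_eq_range A a s z] using h

/-- The near-field count of `NearFieldConvexity` (a `Nat.card` of a subtype, inline predicate) is the
cardinality of the finset of non-`η`-layered sites of `Ω`. -/
theorem nl_card_inline_eq {N : ℕ} (η : ℝ) (x : Fin N → E3) (Ω : Finset (Fin N)) :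
    Nat.card {i : Fin N // i ∈ Ω ∧ ¬ (∃ (A : E3 →ₗᵢ[ℝ] E3) (t : E3) (a : ℝ) (s : ℤ → ℤ) (z : ℤ → ℝ),
      47 / 50 ≤ a ∧ a ≤ 1 ∧ IsHaggSeq s ∧
      (∀ m : ℤ, 39 / 50 * a ≤ z (m + 1) - z m ∧ z (m + 1) - z m ≤ 17 / 20 * a) ∧
      let S : Set E3 := {p | ∃ m i j : ℤ, p = A (((i : ℝ) • triangularVec₁ a) +
        ((j : ℝ) • triangularVec₂ a) + ((haggLabel s m : ℝ) • barlowOffset a) + (z m • layerNormal 1))}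
      (∀ j : Fin N, dist (x j) (x i) ≤ 2 → ∃ p ∈ S, dist (x j + t) p ≤ η) ∧
        (∀ p ∈ S, dist p (x i + t) ≤ 2 → ∃ j : Fin N, dist (x j + t) p ≤ η))} =
      (Ω.filter fun i => ¬ LayeredNear η x i).card := by
  rw [Nat.card_eq_fintype_card, Fintype.card_subtype]
  congr 1
  ext i
  simp only [Finset.mem_filter, Finset.mem_univ, true_and]
  exact and_congr Iff.rfl (not_congr (nl_layeredNear_iff η x i))

/-- The boundary count of `NearFieldConvexity` (a `Nat.card` of a subtype) is the cardinality of the finset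
of sites of `Ω` within `ρ` of a site outside `Ω`. -/
theorem nl_card_bdry_eq {N : ℕ} (x : Fin N → E3) (Ω : Finset (Fin N)) (ρ : ℝ) :
    Nat.card {i : Fin N // i ∈ Ω ∧ ∃ j : Fin N, j ∉ Ω ∧ dist (x j) (x i) ≤ ρ} =
      (Ω.filter fun i => ∃ j : Fin N, j ∉ Ω ∧ dist (x j) (x i) ≤ ρ).card := by
  rw [Nat.card_eq_fintype_card, Fintype.card_subtype]
  congr 1
  ext i
  simp only [Finset.mem_filter, Finset.mem_univ, true_and]

/-- **The near-field inequality for one configuration, solved for the non-layered count.** If the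
`NearFieldConvexity` inequality (charge `c`, boundary constant `C`, depth `4`) holds for a set `Ω` of sites
of a `δ`-separated configuration, then `c · #{i : ¬ LayeredNear η x i}` is at most the total excess
`E(x) − N·e*` plus `(max C 0 · (8/δ+1)³ + (125/6)·δ⁻⁶ + |e*| + c) · #Ωᶜ` (packing count for the boundary
layer, half site energies bounded below on `Ωᶜ`). -/
theorem nl_ineq {N : ℕ} {δ η c C : ℝ} (hδ : 0 < δ) (hc : 0 < c)
    {x : Fin N → E3} (hsep : ∀ i j : Fin N, i ≠ j → δ ≤ dist (x i) (x j)) (Ω : Finset (Fin N))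
    (hΩ : c * ((Ω.filter fun i => ¬ LayeredNear η x i).card : ℝ)
          - C * ((Ω.filter fun i => ∃ j : Fin N, j ∉ Ω ∧ dist (x j) (x i) ≤ 4).card : ℝ)
        ≤ ∑ i ∈ Ω, ((1 / 2 : ℝ) * siteEnergy lennardJones x i -
            (⨅ Q : PeriodicConfiguration 3, Q.energyPerParticle lennardJones))) :
    c * ((Finset.univ.filter fun i => ¬ LayeredNear η x i).card : ℝ) ≤
      (interactionEnergy lennardJones x -
          (N : ℝ) * (⨅ Q : PeriodicConfiguration 3, Q.energyPerParticle lennardJones)) +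
        (max C 0 * (2 * 4 / δ + 1) ^ 3 +
          (125 / 6 * δ⁻¹ ^ 6 + |⨅ Q : PeriodicConfiguration 3, Q.energyPerParticle lennardJones|) + c) *
          ((Ωᶜ).card : ℝ) := by
  rw [squeeze_iInf_eq_eStar] at hΩ ⊢
  rw [← squeeze_sum_excess]
  set e : ℝ := ChargedEnergyGapNegative.eStar with he
  set M : ℝ := (2 * 4 / δ + 1) ^ 3 with hM
  -- the boundary layer of `Ω` is within `4` of the complement
  have hbdry : ((Ω.filter fun i => ∃ j : Fin N, j ∉ Ω ∧ dist (x j) (x i) ≤ 4).card : ℝ) ≤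
      M * (Ωᶜ).card := by
    have hsub : (Ω.filter fun i => ∃ j : Fin N, j ∉ Ω ∧ dist (x j) (x i) ≤ 4) ⊆
        Finset.univ.filter fun i : Fin N => ∃ j ∈ Ωᶜ, dist (x j) (x i) ≤ 4 := by
      intro i hi
      obtain ⟨-, j, hj, hji⟩ := Finset.mem_filter.1 hi
      exact Finset.mem_filter.2 ⟨Finset.mem_univ _, j, Finset.mem_compl.2 hj, hji⟩
    calc ((Ω.filter fun i => ∃ j : Fin N, j ∉ Ω ∧ dist (x j) (x i) ≤ 4).card : ℝ)
        ≤ ((Finset.univ.filter fun i : Fin N => ∃ j ∈ Ωᶜ, dist (x j) (x i) ≤ 4).card : ℝ) := by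
          exact_mod_cast Finset.card_le_card hsub
      _ ≤ M * (Ωᶜ).card := squeeze_card_filter_exists_near_le hδ (by norm_num) hsep Ωᶜ
  -- the excess on `Ω` is at most the total excess plus `(B + |e*|)·#Ωᶜ`
  have hsum : ∑ i ∈ Ω, ((1 / 2 : ℝ) * siteEnergy lennardJones x i - e) ≤
      (∑ i, ((1 / 2 : ℝ) * siteEnergy lennardJones x i - e)) +
        (125 / 6 * δ⁻¹ ^ 6 + |e|) * (Ωᶜ).card := by
    rw [← Finset.sum_add_sum_compl Ω (fun i => (1 / 2 : ℝ) * siteEnergy lennardJones x i - e)]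
    have hlow : ∀ i ∈ Ωᶜ, -(125 / 6 * δ⁻¹ ^ 6 + |e|) ≤
        (1 / 2 : ℝ) * siteEnergy lennardJones x i - e := by
      intro i _
      have h1 := squeeze_neg_le_half_siteEnergy hδ hsep i
      have h2 := le_abs_self e
      linarith
    have h1 : ∑ _i ∈ Ωᶜ, -(125 / 6 * δ⁻¹ ^ 6 + |e|) ≤
        ∑ i ∈ Ωᶜ, ((1 / 2 : ℝ) * siteEnergy lennardJones x i - e) :=
      Finset.sum_le_sum hlow
    rw [Finset.sum_const, nsmul_eq_mul] at h1
    linarith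
  -- a non-layered site is a non-layered site of `Ω` or a site of `Ωᶜ`
  have hsplit : ((Finset.univ.filter fun i => ¬ LayeredNear η x i).card : ℝ) ≤
      ((Ω.filter fun i => ¬ LayeredNear η x i).card : ℝ) + (Ωᶜ).card := by
    have hsub : (Finset.univ.filter fun i => ¬ LayeredNear η x i) ⊆
        (Ω.filter fun i => ¬ LayeredNear η x i) ∪ Ωᶜ := by
      intro i hi
      by_cases hio : i ∈ Ω
      · exact Finset.mem_union_left _ (Finset.mem_filter.2 ⟨hio, (Finset.mem_filter.1 hi).2⟩)
      · exact Finset.mem_union_right _ (Finset.mem_compl.2 hio)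
    calc ((Finset.univ.filter fun i => ¬ LayeredNear η x i).card : ℝ)
        ≤ (((Ω.filter fun i => ¬ LayeredNear η x i) ∪ Ωᶜ).card : ℝ) := by
          exact_mod_cast Finset.card_le_card hsub
      _ ≤ _ := by exact_mod_cast Finset.card_union_le _ _
  have hCmax : C * ((Ω.filter fun i => ∃ j : Fin N, j ∉ Ω ∧ dist (x j) (x i) ≤ 4).card : ℝ) ≤
      max C 0 * (M * (Ωᶜ).card) :=
    calc C * ((Ω.filter fun i => ∃ j : Fin N, j ∉ Ω ∧ dist (x j) (x i) ≤ 4).card : ℝ)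
        ≤ max C 0 * ((Ω.filter fun i => ∃ j : Fin N, j ∉ Ω ∧ dist (x j) (x i) ≤ 4).card : ℝ) :=
          mul_le_mul_of_nonneg_right (le_max_left _ _) (by positivity)
      _ ≤ max C 0 * (M * (Ωᶜ).card) := mul_le_mul_of_nonneg_left hbdry (le_max_right _ _)
  have h5 : c * ((Finset.univ.filter fun i => ¬ LayeredNear η x i).card : ℝ) ≤
      c * ((Ω.filter fun i => ¬ LayeredNear η x i).card : ℝ) + c * (Ωᶜ).card := by
    have := mul_le_mul_of_nonneg_left hsplit hc.le
    linarith
  have hfinal : c * ((Finset.univ.filter fun i => ¬ LayeredNear η x i).card : ℝ) ≤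
      (∑ i, ((1 / 2 : ℝ) * siteEnergy lennardJones x i - e)) +
        ((125 / 6 * δ⁻¹ ^ 6 + |e|) * (Ωᶜ).card + max C 0 * (M * (Ωᶜ).card) + c * (Ωᶜ).card) := by
    linarith
  calc c * ((Finset.univ.filter fun i => ¬ LayeredNear η x i).card : ℝ) ≤ _ := hfinal
    _ = _ := by ring

/-- **S2 — the non-layered fraction vanishes.** `NearFieldConvexity` at fixed `η`, applied with `Ω :=` the
two-shell-good sites of the ground state `x N` (separation `δ` from `LennardJonesMinimalDistance_holds`),
gives `c · #{i : ¬ LayeredNear η (x N) i} ≤ (E(x N) − N·e*) + K · #{i : ¬ 1/20-good}` (`nl_ineq`); the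
first term is `o(N)` (`squeeze_tendsto_excess_div`) and the second is `o(N)` by hypothesis. -/
theorem stub_nonLayeredFraction (hNF : NearFieldConvexity) (x : (N : ℕ) → (Fin N → E3))
    (hx : ∀ N, IsGroundState lennardJones (x N))
    (hbad : Tendsto (fun N : ℕ =>
      (Nat.card {i : Fin N // ¬ IsTwoShellGood (1 / 20) (47 / 50) 1 (x N) i} : ℝ) / N) atTop (𝓝 0))
    {η : ℝ} (hη : 0 < η) :
    Tendsto (fun N : ℕ =>
      ((Finset.univ.filter fun i : Fin N => ¬ LayeredNear η (x N) i).card : ℝ) / N) atTop (𝓝 0) := by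
  obtain ⟨δ, hδ, hsepall⟩ := LennardJonesMinimalDistance_holds
  obtain ⟨c, hc, C, hmain⟩ := hNF δ hδ η hη
  set K : ℝ := max C 0 * (2 * 4 / δ + 1) ^ 3 +
    (125 / 6 * δ⁻¹ ^ 6 + |⨅ Q : PeriodicConfiguration 3, Q.energyPerParticle lennardJones|) + c with hK
  -- the per-`N` inequality
  have hkey : ∀ N : ℕ, c * ((Finset.univ.filter fun i : Fin N => ¬ LayeredNear η (x N) i).card : ℝ) ≤
      (interactionEnergy lennardJones (x N) -
          (N : ℝ) * (⨅ Q : PeriodicConfiguration 3, Q.energyPerParticle lennardJones)) +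
        K * (Nat.card {i : Fin N // ¬ IsTwoShellGood (1 / 20) (47 / 50) 1 (x N) i} : ℝ) := by
    intro N
    have hsep := hsepall N (x N) (hx N)
    set Ω := Finset.univ.filter fun i : Fin N => IsTwoShellGood (1 / 20) (47 / 50) 1 (x N) i with hΩ
    have hgood : ∀ i ∈ Ω, IsTwoShellGood (1 / 20) (47 / 50) 1 (x N) i := fun i hi =>
      (Finset.mem_filter.1 hi).2
    have hcompl : Nat.card {i : Fin N // ¬ IsTwoShellGood (1 / 20) (47 / 50) 1 (x N) i} = (Ωᶜ).card := by
      rw [Nat.card_eq_fintype_card, Fintype.card_subtype]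
      congr 1
      ext i
      simp [hΩ]
    have h0 : c * ((Ω.filter fun i => ¬ LayeredNear η (x N) i).card : ℝ)
        - C * ((Ω.filter fun i => ∃ j : Fin N, j ∉ Ω ∧ dist (x N j) (x N i) ≤ 4).card : ℝ)
        ≤ ∑ i ∈ Ω, ((1 / 2 : ℝ) * siteEnergy lennardJones (x N) i -
            (⨅ Q : PeriodicConfiguration 3, Q.energyPerParticle lennardJones)) := by
      rw [← nl_card_inline_eq η (x N) Ω, ← nl_card_bdry_eq (x N) Ω 4]
      exact hmain N (x N) hsep Ω hgood
    rw [hcompl]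
    exact nl_ineq hδ hc hsep Ω h0
  -- the limit
  have hlim : Tendsto (fun N : ℕ => 1 / c * ((interactionEnergy lennardJones (x N) -
      (N : ℝ) * (⨅ Q : PeriodicConfiguration 3, Q.energyPerParticle lennardJones)) / N +
      K * ((Nat.card {i : Fin N // ¬ IsTwoShellGood (1 / 20) (47 / 50) 1 (x N) i} : ℝ) / N)))
      atTop (𝓝 0) := by
    have h := ((squeeze_tendsto_excess_div x hx).add (hbad.const_mul K)).const_mul (1 / c)
    simpa only [mul_zero, add_zero] using h
  refine squeeze_zero (fun N => by positivity) (fun N => ?_) hlim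
  calc ((Finset.univ.filter fun i : Fin N => ¬ LayeredNear η (x N) i).card : ℝ) / N
      = c * ((Finset.univ.filter fun i : Fin N => ¬ LayeredNear η (x N) i).card : ℝ) / (c * N) :=
        (mul_div_mul_left _ _ hc.ne').symm
    _ ≤ ((interactionEnergy lennardJones (x N) -
          (N : ℝ) * (⨅ Q : PeriodicConfiguration 3, Q.energyPerParticle lennardJones)) +
        K * (Nat.card {i : Fin N // ¬ IsTwoShellGood (1 / 20) (47 / 50) 1 (x N) i} : ℝ)) / (c * N) :=
        div_le_div_of_nonneg_right (hkey N) (by positivity)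
    _ = 1 / c * ((interactionEnergy lennardJones (x N) -
          (N : ℝ) * (⨅ Q : PeriodicConfiguration 3, Q.energyPerParticle lennardJones)) / N +
        K * ((Nat.card {i : Fin N // ¬ IsTwoShellGood (1 / 20) (47 / 50) 1 (x N) i} : ℝ) / N)) := by
        ring

end Summit.AtomisticToContinuum.Crystallization.Theorems.HullBridgeExact

end
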